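import Summits.BirchSwinnertonDyer.BirchSwinnertonDyer.Theses.PrintX10b
import Summits.BirchSwinnertonDyer.BirchSwinnertonDyer.Theorems.PrintX10bHowardContainmentAnyClassNumberX10bThm413Hyp
import Literature.NumberTheory.EllipticCurves.CastellaGrossiSkinner2025.HeegnerKolyvaginBoundAnyClassNumberProofs
import Literature.NumberTheory.EllipticCurves.HeegnerCharIdealScalingEqProofs
import Literature.NumberTheory.EllipticCurves.HeegnerCharIdealEnvelopePowTransferProofs
import Literature.NumberTheory.EllipticCurves.IwasawaAlgebraPromotionProofs
import Summits.BirchSwinnertonDyer.BirchSwinnertonDyer.Theorems.SmallImageMuTransferMuTransferStubX9MuBookkeeping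
import HarnessLib

/-!
# Line `omega-adic-mu-x10b` — REV 2r (bsd-idea-5 g6, 2026-08-28; lens «transfer»)

REV 2r = a RECONSTRUCTION of the g5 rev 2 (announced sha16 e63df7d18cab353e, `lean check` rc 0, whose tree write never
landed — farm rc 75 — and whose source sits only in gate evidence, unreadable from this seat) from rev 1 (tree sha16
76d5dea66cdea60d) + the rev-2 card `Lines/omega-adic-mu-x10b.md` §"Rev 2". Content of rev 2 kept: Ω2 SPLIT by the
tree's `WeierstrassCurve.reductionPointCount` into Ω2a (non-anomalous, PORT modulo the residual R-MR) / Ω2c (anomalous,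
RESEARCH), `stub_omegaAdicCorankOne` DERIVED (`omegaAdicCorankOne_of_cases`); the live split crux stmt-27487
`PrintX10b.MuPartSharpX10b` concluded BY NAME (`muPartSharpX10b_of_stubs`), and the parent 27275 through the route's
own split items 27485/27486/27488 BY NAME (`parent_of_split`). ONE CORRECTION (g6 finding F3, §2 docstring of
`Stmt.rungF2`): the Ω1 rung F2 is typed over the STABILISED class module `Λκ_∞(C)` (bottom layer
`u_K⁻¹(1-α⁻¹)²·δ(y_K)` at EVERY torsion depth, CGLS22 Rem. 4.1.2), not over Howard's family module `ℋ_F`, whose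
bottom at depth `δ = 0` is `Φ·y_K` (Howard 2004 Lemmas 3.3.2–3.3.3) but whose generators change at `δ ≥ 1`.
Sorries = exactly the five open `stub_*`: `stub_envelopeGeom` (shared with the line of record), `stub_kappaIndivisible`
(Ω1), `stub_omegaAdicCorankOne_nonAnomalous` (Ω2a), `stub_omegaAdicCorankOne_anomalous` (Ω2c), `stub_rungF2` (Ω1-F2♭,
a rung, NOT in the cone). Publish-only (W-79): the line of record of 23729 / 27487 is untouched. BSD is not proved by
any of this.

# (rev-1 header, kept) Line `omega-adic-mu-x10b` (bsd-idea-5 g4, lens «transfer») — the μ-PART of the X10b Howard containment read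
# with a Kolyvagin system over `Ω = Λ/3Λ = 𝔽₃⟦T⟧`; published under stmt-BirchSwinnertonDyer-23729
# `PrintX10b.HowardContainmentAnyClassNumberX10b` (aside), concluding the route's LIVE DECIDING crux
# stmt-BirchSwinnertonDyer-27275 `PrintX10b.HowardContainmentLightFrameX10bPinnedOfPrint` (rev 31) BY NAME, and with
# it stmt-27274 `PrintX10b.HowardContainmentLightFrameX10bPinned` from the four print binders.

HONEST FRAMING: a SKELETON — sorries ONLY in the three open `stub_*` (`stub_envelopeGeom` is the line-of-record's
own stub, shared verbatim; `stub_kappaIndivisible` (Ω1), `stub_omegaAdicCorankOne` (Ω2) are new; the third new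
statement Ω3 turned out to be IN THE TREE and is proved, not stubbed); the compositions are sorry-free and conclude
the route decls by name; nothing is closed; no summit
statement is proved; BSD is not proved by any of this. Publish-only (W-79): the line of record stays
`torsion_depth_x10b` (lead x10b-p2, rev-22 variant `torsion_depth_x10b_pinned_v22.lean`). WHAT THIS LINE ADDS TO IT:
the lead's one beyond-print stub `Stmt.muPartTied` (verbatim below) is DERIVED here — `muPartTied_of_omega :
Ω1 → Ω2 → Ω3 → AnticyclotomicTowerSharp → Stmt.muPartTied` — so the composition is the lead's, with `s_mu`
replaced by three typed statements of a different mechanism. (A 7-stub variant concluding the aside item 26623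
on the broad frames, with the even-`d_K` and theta-congruent residues, was checked rc 0 as well and is kept in the
seat folder only: `line-omega-adic-mu-x10b-26623.lean`.)

## The lever (new on this crux): a Kolyvagin system with coefficients in `Ω := Λ/3Λ = 𝔽₃⟦T⟧`

Every printed engine reads Howard's divisibility at a height-one prime `𝔓` by SPECIALISING the `Λ`-adic Heegner
Kolyvagin system to the characteristic-zero DVR `S_𝔓` (Howard 2004 §2.2 = MR04 Thm 5.3.10); the prime `𝔓 = pΛ`
is reached only through the approaching primes `q_m = (T^m + p)` (Howard 2004, arXiv:1202.6340 p. 18: "entirely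
similar fashion"), and at `p ∣ h_K` that is exactly the step that breaks: CGLS 2022's error term `E_α ∝
rank_{ℤ_p} S_{q_m} = m` is unbounded (Thm 3.3.1 proof, arXiv:2008.02571 p. 21), whence only `char(X_tors) ∣
(3^m)·I(Λκ_∞)²` (their Thm 3.4.1 / 4.1.3, CGS 2025 Thm 6.5.2). This line does NOT specialise. It REDUCES THE
COEFFICIENTS MOD 3 ONCE: `κ̄ := κ^{Hg} ⊗ Λ/3` is a Kolyvagin system for `T_Ω := E[3] ⊗_{𝔽₃} Ω(Ψ̄)` over the
equal-characteristic complete DVR `Ω` (levels `Ω/T^k`, principal artinian: MR04 §4.4; Sakamoto 2018 "Stark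
systems over Gorenstein local rings" is the abstract sibling). `κ̄` is MR04's image of `κ^{Hg}` in `KS(T ⊗ Λ/pΛ)`
— the `𝔓 = pΛ` member of the "blind spot" family of Def 5.3.9 (KKS20 Def 4.17) — which print uses only through
"≠ 0" (Λ-primitivity ⇒ main-conjecture equality, MR 5.3.10(iii), KKS Thm 4.20); here it is used as a BOUNDING
DEVICE in its own right:
* `μ(X_tors) = 0 ⟺ X_tors/3·X_tors` is FINITE `⟺ corank_Ω Sel(K_∞, E[3]) = 1` (Shapiro: `H¹_𝓕(K, A_Ω) =
  Sel(K_∞, E[3])`; control mod 3 up to FINITE errors since `E(K_∞)[3] = 0` under (irr_K) and the primes of `K_∞`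
  above `3N` are finitely many) — an `Ω`-RANK statement, insensitive to every finite-index error, in particular to
  the class-number / torsion-depth error ideals that cost CGLS the powers of `3`;
* the `Ω`-adic Kolyvagin–Howard bound ("`κ̄₁` `Ω`-non-torsion ⇒ `rank_Ω H¹_𝓕(K, T_Ω) = 1 = corank_Ω H¹_𝓕(K, A_Ω)`")
  is the transfer of Howard 2004 Thm 1.6.1 / §2.2 from (`ℤ_p/p^k`, `S_𝔓`) to (`Ω/T^k`, `Ω`);
* X10b is where the transfer is CHEAPEST: `ρ̄_{E,3}(G_K)` is a 2-GROUP (¬Surj ∧ Irr ⇒ image in the 2-Sylow `SD₁₆`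
  of `GL₂(𝔽₃)`), so `H^i(K(T_Ω/T^k)/K, T_Ω/T^k) = 0` EXACTLY for all `k` (prime-to-3 part without fixed vectors by
  (irr_K); its 3-part `Gal(K_j/K)` then sees the zero module) — no Sah lemma, no scalar hypothesis; and the
  Kolyvagin primes (`ℓ` inert, `Frob_ℓ = τ` on `K(E[3])`, i.e. `M(ℓ) ≥ 1`) serve EVERY level `k` at once
  (`λ = ℓ𝒪_K` splits completely in `K_∞`: `H¹_f(K_λ, T_Ω/T^k) = T_Ω/(T^k, τ-1)` free of rank one over `Ω/T^k`);
* the INPUT "`κ̄₁` is `Ω`-non-torsion" is `μ(𝔖/Λκ_∞) = 0`, i.e. `κ_∞ ∉ 3𝔖`, CERTIFIED ON THE ANALYTIC SIDE: the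
  `Λ`-adic BDP explicit reciprocity law (`𝓛og_v(loc_v κ_∞)` is `𝓛_v^{BDP}` up to a unit of `Λ^ur`, the big logarithm
  `Λ`-linear and integral — Castella–Hsieh 2018, used at any class number in CGLS22 Prop 4.2.1 via BCK21) ×
  `μ(𝓛^{BDP}) = 0` (Hsieh 2014 Thm B = `BurungaleCastellaSkinner2025.prop422_exists_isBDPLFunction_mu_eq_zero`,
  binders (disc) odd, (spl), (irr_K), NO class-number hypothesis). No main conjecture, no Kolyvagin conjecture.
Transfer dictionary: `ℤ_p/p^k ↦ Ω/T^k`; `S_𝔓 ↦ Ω`; "κ₁^{(𝔓)} generates an infinite `S_𝔓`-module" ↦ "`κ̄₁` is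
`Ω`-non-torsion" ↦ `μ(𝔖/Λκ_∞) = 0`; Kolyvagin primes of depth `≥ k` ↦ all Kolyvagin primes; `length_{ℤ_p}` ↦
`Ω`-rank. Siblings in print: cyclotomic — Kim–Kim–Sun 2020 Prop 4.19/Thm 4.20 (residual Kato KS `≠ 0` ⇒
Λ-primitive ⇒ `μ = 0` AND the IMC, through MR 5.3.10(iii)); anticyclotomic big image — BCK21 / BCGS (IMC ⇒
Kolyvagin's conjecture). Both pass through a main conjecture; this line extracts the μ-shard without one.

## Stubs (sorries only here; 3 open + 2 proved)
* `stub_coprimeTied` — PROVED (the lead's proof: MZ26 Cor 4.6 by name, p607508);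
* `stub_envelopeGeom` — OPEN, shared VERBATIM with the line of record (V22): print-free CM geometry + Kummer theory;
* `stub_kappaIndivisible` (Ω1, M, print modulo typing: ERL × Hsieh Thm B) — NEW;
* `stub_omegaAdicCorankOne` (Ω2, L, RESEARCH — the lever, hardest) — NEW;
* `lengthAtP_eq_zero_of_finiteQuotient_holds` (Ω3, pure `Λ`-algebra) — PROVED from the tree
  (`Rank1Residual.KatoMuSkeleton.lengthAt_eq_zero_of_finite_quotient_p`, found by the seat's crux probe).
Kernel (sorry-free): `muPartTied_of_omega` (the lead's μ-stub from Ω1–Ω3 via the promotion lemma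
`IwasawaAlgebra.le_charIdeal_of_span_p_pow_mul_le`, p607965) and the lead's V22 composition, verbatim, against the
route's rev-31 decls. FINDING (card §F1): under Ω1 the reverse envelope `g•Λκ_∞(C) ⊆ ℋ_F` gives
`μ(𝔖/ℋ_F) ≤ μ(Λ/g)`; at torsion depth `δ = 0` (`Λκ_∞(C) = ℋ_F`, idea-16's v2 finding) and whenever `g` is prime
to `3`, `μ(𝔖/ℋ_F) = 0`, and THERE the μ-INEQUALITY re-cut `μ(X_tors) ≤ 2μ(𝔖/ℋ_F)` (V22 `muPartTied_of_muInequality`,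
idea-16, x10b-p1) is EQUIVALENT to `μ(X_tors) = 0`: the two open μ-roads meet. Disproof / negatives: no `Disproof.lean` in the crux dirs of 23729 /
27275; the theta-congruent obstruction (FINDING-theta-congruent-mu, g3) is honoured by the (irr_K) frame binder,
which the light frame carries.
-/

set_option linter.dupNamespace false
set_option autoImplicit false

noncomputable section

open scoped Classical Pointwise
open Literature Literature.NumberTheory.EllipticCurves WeierstrassCurve
  Literature.NumberTheory.EllipticCurves.ModularForms
open Literature.NumberTheory.EllipticCurves.Rank1Residual (ClassX10 Surj)
open Summit.BirchSwinnertonDyer.BirchSwinnertonDyer.Theses.PrintX10b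
  (MastellaZermanHowardDivisibility CGLSHeegnerClassNonvanishing CGSHowardDivisibilityPLocalized
    AnticyclotomicTowerSharp HowardContainmentLightFrameX10bPinned HowardContainmentLightFrameX10bPinnedOfPrint
    MuPartSharpX10b CoprimeTiedX10b EnvelopeModulesSharpX10b HowardContainmentLightFrameX10bPinnedOfPrintOfSplit)

namespace Summit.BirchSwinnertonDyer.BirchSwinnertonDyer.Cruxes.HowardContainmentAnyClassNumberX10b.OmegaAdicMuX10b

/-! ## §1 Statements shared VERBATIM with the line of record (V22; LIGHT X10b frame binders) -/

/-- s_cop (PROVED below): the `3 ∤ h_K` regime, tied (MZ26 Cor. 4.6 by name).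
[cite: MastellaZerman2026, Cor. 4.6 (arXiv:2505.08710)] -/
def Stmt.coprimeTied : Prop :=
  MastellaZermanHowardDivisibility →
    ∀ (W : WeierstrassCurve ℚ) [W.IsElliptic] [W.IsGloballyMinimal] (p : ℕ) [Fact p.Prime]
      [NeZero (W.conductorNorm ℤ)] (K : Type) [Field K] [NumberField K],
      ClassX10 W p → ¬ Surj W 3 → ¬ W.HasCM →
      IsImaginaryQuadratic K → Odd (NumberField.discr K) → NumberField.discr K ≠ -3 →
      SatisfiesHeegnerHypothesis (W.conductorNorm ℤ) K → SatisfiesHeegnerHypothesis p K →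
      (W.baseChange K).HasIrreducibleModPGaloisRep p →
      ∀ (κ : ZpExtension K p), κ.IsAnticyclotomic → ∀ (γ : Field.absoluteGaloisGroup K),
      κ.IsTopGenerator γ →
      ∀ (Dt : ModularParametrizationData W (W.conductorNorm ℤ))
        (H : HeegnerDatum (W.conductorNorm ℤ) (NumberField.discr K)) (ιC : K →+* ℂ)
        (jbar : AlgebraicClosure K →+* ℂ),
      ¬ (p : ℤ) ∣ Dt.c → (W.baseChange K).mordellWeilRank = 1 →
      Finite (AddCommGroup.primaryComponent (W.baseChange K).sha p) →
      ¬ p ∣ NumberField.classNumber K →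
      ∃ (D : (W.baseChange K).LambdaAdicSelmerData κ γ)
        (F : HeegnerFamily (W.conductorNorm ℤ) W K κ jbar) (X : (W.baseChange K).SelmerDualData κ γ),
        F.Dt = Dt ∧ heegnerCharIdeal D F ^ 2 ≤
          Module.charIdeal (IwasawaAlgebra p) (Submodule.torsion (IwasawaAlgebra p) X.X)

/-- s_envGeom (OPEN, the line of record's own stub, verbatim): the PRINT-FREE geometric envelope — from the
sharpened tower, a COHERENT pair (`C`, `F`) on the frame's `Dt` with `(p^e)•ℋ_F ≤ Λκ_∞(C)` and `g•Λκ_∞(C) ≤ ℋ_F`,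
`g ≠ 0`. [cite: Howard2004HeegnerKolyvagin, §3.3] [cite: PerrinRiou1987BSMF, §3.3–3.4]
[cite: CastellaGrossiLeeSkinner2022, §4.1, Rem. 4.1.4] -/
def Stmt.envelopeGeom : Prop :=
  AnticyclotomicTowerSharp →
    ∀ (W : WeierstrassCurve ℚ) [W.IsElliptic] [W.IsGloballyMinimal] (p : ℕ) [Fact p.Prime]
      [NeZero (W.conductorNorm ℤ)] (K : Type) [Field K] [NumberField K],
      ClassX10 W p → ¬ Surj W 3 → ¬ W.HasCM →
      IsImaginaryQuadratic K → Odd (NumberField.discr K) → NumberField.discr K ≠ -3 →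
      SatisfiesHeegnerHypothesis (W.conductorNorm ℤ) K → SatisfiesHeegnerHypothesis p K →
      (W.baseChange K).HasIrreducibleModPGaloisRep p →
      ∀ (κ : ZpExtension K p), κ.IsAnticyclotomic → ∀ (γ : Field.absoluteGaloisGroup K),
      κ.IsTopGenerator γ →
      ∀ (Dt : ModularParametrizationData W (W.conductorNorm ℤ))
        (H : HeegnerDatum (W.conductorNorm ℤ) (NumberField.discr K))
        (jbar : AlgebraicClosure K →+* ℂ) (D : (W.baseChange K).LambdaAdicSelmerData κ γ),
      ¬ (p : ℤ) ∣ Dt.c →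
      ∃ (C : CastellaGrossiLeeSkinner2022.StabilizedHeegnerData (W.conductorNorm ℤ) W K κ jbar)
        (F : HeegnerFamily (W.conductorNorm ℤ) W K κ jbar) (e : ℕ) (g : IwasawaAlgebra p),
        C.Dt = Dt ∧ F.Dt = Dt ∧
        ((p : IwasawaAlgebra p) ^ e) • heegnerModule D F ≤ CastellaGrossiLeeSkinner2022.stabilizedHeegnerModule D C ∧
        g ≠ 0 ∧ g • CastellaGrossiLeeSkinner2022.stabilizedHeegnerModule D C ≤ heegnerModule D F

/-- s_mu (the line of record's beyond-print stub, verbatim — NOT a stub here: DERIVED from Ω1–Ω3 below). -/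
def Stmt.muPartTied : Prop :=
    ∀ (W : WeierstrassCurve ℚ) [W.IsElliptic] [W.IsGloballyMinimal] (p : ℕ) [Fact p.Prime]
      [NeZero (W.conductorNorm ℤ)] (K : Type) [Field K] [NumberField K],
      ClassX10 W p → ¬ Surj W 3 → ¬ W.HasCM →
      IsImaginaryQuadratic K → Odd (NumberField.discr K) → NumberField.discr K ≠ -3 →
      SatisfiesHeegnerHypothesis (W.conductorNorm ℤ) K → SatisfiesHeegnerHypothesis p K →
      (W.baseChange K).HasIrreducibleModPGaloisRep p →
      ∀ (κ : ZpExtension K p), κ.IsAnticyclotomic → ∀ (γ : Field.absoluteGaloisGroup K),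
      κ.IsTopGenerator γ →
      ∀ (Dt : ModularParametrizationData W (W.conductorNorm ℤ))
        (H : HeegnerDatum (W.conductorNorm ℤ) (NumberField.discr K)) (ιC : K →+* ℂ)
        (jbar : AlgebraicClosure K →+* ℂ),
      ¬ (p : ℤ) ∣ Dt.c → (W.baseChange K).mordellWeilRank = 1 →
      Finite (AddCommGroup.primaryComponent (W.baseChange K).sha p) →
      p ∣ NumberField.classNumber K →
      (∃ (D : (W.baseChange K).LambdaAdicSelmerData κ γ)
          (F : HeegnerFamily (W.conductorNorm ℤ) W K κ jbar) (X : (W.baseChange K).SelmerDualData κ γ) (m : ℕ),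
          F.Dt = Dt ∧ Module.Finite (IwasawaAlgebra p) D.S ∧ Module.Finite (IwasawaAlgebra p) X.X ∧
          Module.IsTorsion (IwasawaAlgebra p) (D.S ⧸ heegnerModule D F) ∧
          Ideal.span {((p : IwasawaAlgebra p) ^ m)} * heegnerCharIdeal D F ^ 2 ≤
            Module.charIdeal (IwasawaAlgebra p) (Submodule.torsion (IwasawaAlgebra p) X.X)) →
      ∃ (D : (W.baseChange K).LambdaAdicSelmerData κ γ)
        (F : HeegnerFamily (W.conductorNorm ℤ) W K κ jbar) (X : (W.baseChange K).SelmerDualData κ γ),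
        F.Dt = Dt ∧ heegnerCharIdeal D F ^ 2 ≤
          Module.charIdeal (IwasawaAlgebra p) (Submodule.torsion (IwasawaAlgebra p) X.X)

/-! ## §2 The new statements Ω1–Ω3 -/

/-- **Ω1 `Stmt.kappaIndivisible` — `μ(𝔖/Λκ_∞(C)) = 0`: SOME stabilized `Λ`-adic Heegner datum `C` (the coherent
printed one) has `𝔖/Λκ_∞(C)` torsion (Cornut–Vatsal, CGLS22 Thm 4.1.1) with NO `(3)`-primary part — the CGLS class
is not divisible by `3` in the free rank-one `𝔖`** — on every LIGHT X10b Heegner frame (odd `d_K ≠ -3`, (irr_K), any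
class number), for the GIVEN `jbar` and every `Λ`-adic Selmer datum `D`, in the tree's `lengthAt` currency. `∃ C`,
not `∀ C`: the structure admits Galois-incoherent twists (layout note of `StabilizedHeegnerData`); the composition
needs one good `C`, untied to `Dt`. PRINT MODULO TYPING: `𝔖` free of rank one (CGLS22 Thm 4.1.3 (i)); the big
logarithm `𝓛og_v` is `Λ`-linear and integral with `𝓛og_v(loc_v κ_∞)² ≐ 𝓛_v^{BDP}` up to a `Λ^ur`-unit
(Castella–Hsieh 2018 ERL, the input of CGLS22 Prop 4.2.1 / BCK21 "Conj A ⟺ Conj B", any class number); and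
`μ(𝓛^{BDP}) = 0` (Hsieh 2014 Thm B = `BurungaleCastellaSkinner2025.prop422_exists_isBDPLFunction_mu_eq_zero`:
`2 < p`, (Heeg), (spl), (disc) odd, `d_K ≠ -3`, (irr_K); NO class-number hypothesis); so `κ_∞ ∈ 3𝔖` would force
`3 ∣ 𝓛_v^{BDP}` in `Λ^ur`. Elementary rung: non-anomalous frames (`a₃ ≢ 1 (3)`) with `y_K ∉ 3E(K)`:
`pr_K(κ_∞) = u_K α²(β-1)² κ₀` (CGLS22 Rem 4.1.2) is a `3`-adic unit multiple of `δ(y_K)` ⇒ `κ_∞ ∉ 𝔪𝔖 ⊇ 3𝔖`, no ERL.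
Why it might fail: the ERL's integral normalisation at anomalous `3` (`a₃ ≡ 1`) for the `d(k)`-shifted class,
and the exact coherent `C` the tower yields (`StabilizedHeegnerData.exists_of_tower`) vs the one BDP sees.
[cite: CastellaGrossiLeeSkinner2022, Rem. 4.1.2, Prop. 4.2.1 (arXiv:2008.02571 p. 22)]
[cite: BurungaleCastellaKim2021, "Conj. A ⟺ Conj. B" (arXiv:1908.09512)] [cite: CastellaHsieh2018, Thm. 5.1 (shape)]
[cite: Hsieh2014, Thm. B] [cite: BurungaleCastellaSkinner2025, Prop. 4.2.2] -/
def Stmt.kappaIndivisible : Prop :=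
  AnticyclotomicTowerSharp →
    ∀ (W : WeierstrassCurve ℚ) [W.IsElliptic] [W.IsGloballyMinimal] (p : ℕ) [Fact p.Prime]
      [NeZero (W.conductorNorm ℤ)] (K : Type) [Field K] [NumberField K],
      ClassX10 W p → ¬ Surj W 3 → ¬ W.HasCM →
      IsImaginaryQuadratic K → Odd (NumberField.discr K) → NumberField.discr K ≠ -3 →
      SatisfiesHeegnerHypothesis (W.conductorNorm ℤ) K → SatisfiesHeegnerHypothesis p K →
      (W.baseChange K).HasIrreducibleModPGaloisRep p →
      ∀ (κ : ZpExtension K p), κ.IsAnticyclotomic → ∀ (γ : Field.absoluteGaloisGroup K),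
      κ.IsTopGenerator γ → ∀ (jbar : AlgebraicClosure K →+* ℂ)
        (D : (W.baseChange K).LambdaAdicSelmerData κ γ),
      ∃ C : CastellaGrossiLeeSkinner2022.StabilizedHeegnerData (W.conductorNorm ℤ) W K κ jbar,
        Module.IsTorsion (IwasawaAlgebra p) (D.S ⧸ CastellaGrossiLeeSkinner2022.stabilizedHeegnerModule D C) ∧
        ∀ 𝔭 : PrimeSpectrum (IwasawaAlgebra p), 𝔭.asIdeal = Ideal.span {(p : IwasawaAlgebra p)} →
          Module.lengthAt (IwasawaAlgebra p)
            (D.S ⧸ CastellaGrossiLeeSkinner2022.stabilizedHeegnerModule D C) 𝔭 = 0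

/-- **Ω2 `Stmt.omegaAdicCorankOne` — THE LEVER (RESEARCH, L): the `Ω`-adic Kolyvagin–Howard bound + control
mod 3.** On a light X10b Heegner frame: if a stabilized `Λ`-adic Heegner datum `C` has `𝔖/Λκ_∞(C)` torsion with
`μ(𝔖/Λκ_∞(C)) = 0` (Ω1's output: `κ̄₁ := κ_∞ mod 3` is `Ω`-non-torsion in `H¹_𝓕(K, T_Ω) ⊇ 𝔖/3𝔖`, `Ω = 𝔽₃⟦T⟧`,
`T_Ω = E[3] ⊗ Ω(Ψ̄)`), then for every Selmer dual datum `X` with `𝒳` finitely generated, `𝒳_{Λ-tors}/3·𝒳_{Λ-tors}`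
is FINITE (no `μ`-blocks). Mechanism: `κ̄ = κ^{Hg} ⊗ Λ/3 ∈ KS(T_Ω, 𝓕_Ω, 𝒫_{M ≥ 1})` (reduction of CGLS22 Thm
4.1.1's system; the Kolyvagin primes serve all levels `Ω/T^k` since inert `λ` split completely in `K_∞`); MR04
§4.4 / Howard 2004 Thm 1.6.1 run over the principal artinian rings `Ω/T^k` (hypotheses: `H^i(K(T_Ω/T^k)/K,
T_Ω/T^k) = 0` — exact here, the image being a 2-group without fixed vectors; Chebotarev choice — the
`𝔽₃[Gal]`-submodules of `E[3] ⊠ Ω/T^k` form the chain `E[3] ⊗ T^i Ω/T^k` even for the non-absolutely-irreducible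
images `C₈`, `C₄` (Schur field `𝔽₉`); self-duality `T_Ω ≃ T_Ω^∨(1)^ι` from the Weil pairing) give `corank_Ω
H¹_𝓕(K, A_Ω) = 1`; Shapiro + control mod 3 (finite local errors at the finitely many primes of `K_∞` above `3N`;
`E(K_∞)[3] = 0`) give `rank_Ω(𝒳/3𝒳) = 1 = rank_Λ 𝒳`, i.e. `𝒳_tors/3` finite. Why it might fail: an `Ω`-length
error in the Kolyvagin induction that is not `O(1)` in `k` (the equal-characteristic analogue of CGLS's `E_α`),
e.g. from the `d(k)`-shift at torsion depth `δ > 0`; Howard's §1.3–1.6 use `char S_𝔓 = 0` in the Cassels–Tate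
structure `M ⊕ M` (only the corank clause is needed here).
[cite: MazurRubin2004, §4.4, Def. 5.3.9, Thm. 5.3.10] [cite: Howard2004HeegnerKolyvagin, Thm. 1.6.1, §2.2 (arXiv:1202.6340 pp. 15–18)]
[cite: Sakamoto2018Gorenstein, Thm. 1.1] [cite: KimKimSun2020, Def. 4.17–4.18, Prop. 4.19, Thm. 4.20 (arXiv:1709.05780 p. 14)]
[cite: CastellaGrossiLeeSkinner2022, Thm. 3.3.1 proof (arXiv:2008.02571 p. 21)] -/
def Stmt.omegaAdicCorankOne : Prop :=
    ∀ (W : WeierstrassCurve ℚ) [W.IsElliptic] [W.IsGloballyMinimal] (p : ℕ) [Fact p.Prime]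
      [NeZero (W.conductorNorm ℤ)] (K : Type) [Field K] [NumberField K],
      ClassX10 W p → ¬ Surj W 3 → ¬ W.HasCM →
      IsImaginaryQuadratic K → Odd (NumberField.discr K) → NumberField.discr K ≠ -3 →
      SatisfiesHeegnerHypothesis (W.conductorNorm ℤ) K → SatisfiesHeegnerHypothesis p K →
      (W.baseChange K).HasIrreducibleModPGaloisRep p →
      ∀ (κ : ZpExtension K p), κ.IsAnticyclotomic → ∀ (γ : Field.absoluteGaloisGroup K),
      κ.IsTopGenerator γ → ∀ (jbar : AlgebraicClosure K →+* ℂ)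
        (D : (W.baseChange K).LambdaAdicSelmerData κ γ)
        (C : CastellaGrossiLeeSkinner2022.StabilizedHeegnerData (W.conductorNorm ℤ) W K κ jbar)
        (X : (W.baseChange K).SelmerDualData κ γ),
      Module.Finite (IwasawaAlgebra p) D.S → Module.Finite (IwasawaAlgebra p) X.X →
      Module.IsTorsion (IwasawaAlgebra p) (D.S ⧸ CastellaGrossiLeeSkinner2022.stabilizedHeegnerModule D C) →
      (∀ 𝔭 : PrimeSpectrum (IwasawaAlgebra p), 𝔭.asIdeal = Ideal.span {(p : IwasawaAlgebra p)} →
          Module.lengthAt (IwasawaAlgebra p)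
            (D.S ⧸ CastellaGrossiLeeSkinner2022.stabilizedHeegnerModule D C) 𝔭 = 0) →
      Finite (↥(Submodule.torsion (IwasawaAlgebra p) X.X) ⧸
        (IwasawaAlgebra.augIdealP p •
          (⊤ : Submodule (IwasawaAlgebra p) ↥(Submodule.torsion (IwasawaAlgebra p) X.X))))

/-- **Ω2a `Stmt.omegaAdicCorankOne_nonAnomalous` (rev 2) — Ω2 on NON-ANOMALOUS frames (`p ∤ #Ẽ(𝔽_p)`, i.e.
`a_p ≢ 1 (mod p)`, typed by the tree's `WeierstrassCurve.reductionPointCount`): PORT modulo the residual R-MR.**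
Desk check (Cruxes/…/DESKCHECK-How04-KS-theory-p7-p12.md, 14 rows over [corpus:paper:arxiv-1202.6340 pp. 7–12]):
every item of Howard 2004 §2.3–2.6 is stated for an abstract principal Artinian ring or DVR, so `Ω/T^k`, `Ω = 𝔽₃⟦T⟧`
qualify verbatim; H.1 is used only as irreducibility over the residue field (= the frame's `(irr_K)`); H.2 for `T_Ω`
vanishes (2-group image, `Hom_Ḡ(ad E[3], E[3]) = 0` for every irreducible `Ḡ ≤ SD₁₆`); H.3 at `v ∣ 3` is EXACT at
non-anomalous `3` (`Ẽ(k_w)[3] = 0`). RESIDUAL R-MR (V#43 caveat, binding on the port seat): the UNREAD Mazur–Rubin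
2004 Lemmas 3.5.4 / 3.7.4 (want acq-09070) may use `End_{G_K}(T̄) = 𝔽_p` (absolute irreducibility); on the `C₈`/`C₄`
X10b frames `End(T̄) = 𝔽₉` — the port seat STOPS AND REPORTS if those lemmas use it (then an Ω2b predicate
"absolutely irreducible residual image" is split off; no such predicate is typed today). Why it might fail: R-MR; an
`Ω`-length error in the Kolyvagin induction not `O(1)` in `k` from the `d(k)`-shift at torsion depth `δ > 0`.
[cite: Howard2004HeegnerKolyvagin, §2.3–2.6, Thm. 1.6.1, Lemma 3.2.7 (arXiv:1202.6340 pp. 7–12, 16–17)]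
[cite: MazurRubin2004, Lemmas 3.5.4, 3.7.4, §4.4] [cite: CastellaGrossiLeeSkinner2022, Thm. 4.1.1] -/
def Stmt.omegaAdicCorankOne_nonAnomalous : Prop :=
    ∀ (W : WeierstrassCurve ℚ) [W.IsElliptic] [W.IsGloballyMinimal] (p : ℕ) [Fact p.Prime]
      [NeZero (W.conductorNorm ℤ)] (K : Type) [Field K] [NumberField K],
      ClassX10 W p → ¬ Surj W 3 → ¬ W.HasCM → ¬ p ∣ W.reductionPointCount p →
      IsImaginaryQuadratic K → Odd (NumberField.discr K) → NumberField.discr K ≠ -3 →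
      SatisfiesHeegnerHypothesis (W.conductorNorm ℤ) K → SatisfiesHeegnerHypothesis p K →
      (W.baseChange K).HasIrreducibleModPGaloisRep p →
      ∀ (κ : ZpExtension K p), κ.IsAnticyclotomic → ∀ (γ : Field.absoluteGaloisGroup K),
      κ.IsTopGenerator γ → ∀ (jbar : AlgebraicClosure K →+* ℂ)
        (D : (W.baseChange K).LambdaAdicSelmerData κ γ)
        (C : CastellaGrossiLeeSkinner2022.StabilizedHeegnerData (W.conductorNorm ℤ) W K κ jbar)
        (X : (W.baseChange K).SelmerDualData κ γ),
      Module.Finite (IwasawaAlgebra p) D.S → Module.Finite (IwasawaAlgebra p) X.X →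
      Module.IsTorsion (IwasawaAlgebra p) (D.S ⧸ CastellaGrossiLeeSkinner2022.stabilizedHeegnerModule D C) →
      (∀ 𝔭 : PrimeSpectrum (IwasawaAlgebra p), 𝔭.asIdeal = Ideal.span {(p : IwasawaAlgebra p)} →
          Module.lengthAt (IwasawaAlgebra p)
            (D.S ⧸ CastellaGrossiLeeSkinner2022.stabilizedHeegnerModule D C) 𝔭 = 0) →
      Finite (↥(Submodule.torsion (IwasawaAlgebra p) X.X) ⧸
        (IwasawaAlgebra.augIdealP p •
          (⊤ : Submodule (IwasawaAlgebra p) ↥(Submodule.torsion (IwasawaAlgebra p) X.X))))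

/-- **Ω2c `Stmt.omegaAdicCorankOne_anomalous` (rev 2) — Ω2 on ANOMALOUS frames (`p ∣ #Ẽ(𝔽_p)`, `a_p ≡ 1 (mod p)`):
RESEARCH (L–XL), not seatable now.** Howard's machine over `Ω/T^k` with a BOUNDED error term: H.3 at `w ∣ 3` has the
finite explicit defect `Ẽ(k_w)[3^∞]` (Howard 2004 Lemma 3.2.7: the cokernel at `v ∣ p` is controlled by
`H⁰(K_{∞,w}, gr_w A) = Ẽ(k_w)[p^∞]`, finite since the residue field of `K_{∞,w}` is finite — at torsion depth `δ` it
is `𝔽_{3^f}` with `f ∣ 3^δ`, and `3 ∣ #Ẽ(𝔽_{3^f})` iff `3 ∣ #Ẽ(𝔽_3)` since `a_{3^f} ≡ a_3 (mod 3)`), the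
equal-characteristic analogue of CGLS22 Thm 3.3.1's `E_α`. Why it might fail: the
H.3 defect may grow with the level `T^k` (a μ-sized loss), exactly the phenomenon that costs CGLS the powers of `p`.
[cite: Howard2004HeegnerKolyvagin, Lemma 3.2.7 (arXiv:1202.6340 pp. 16–17)] [cite: CastellaGrossiLeeSkinner2022, Thm. 3.3.1 proof (arXiv:2008.02571 p. 21)]
[cite: MazurRubin2004, §4.4] -/
def Stmt.omegaAdicCorankOne_anomalous : Prop :=
    ∀ (W : WeierstrassCurve ℚ) [W.IsElliptic] [W.IsGloballyMinimal] (p : ℕ) [Fact p.Prime]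
      [NeZero (W.conductorNorm ℤ)] (K : Type) [Field K] [NumberField K],
      ClassX10 W p → ¬ Surj W 3 → ¬ W.HasCM → p ∣ W.reductionPointCount p →
      IsImaginaryQuadratic K → Odd (NumberField.discr K) → NumberField.discr K ≠ -3 →
      SatisfiesHeegnerHypothesis (W.conductorNorm ℤ) K → SatisfiesHeegnerHypothesis p K →
      (W.baseChange K).HasIrreducibleModPGaloisRep p →
      ∀ (κ : ZpExtension K p), κ.IsAnticyclotomic → ∀ (γ : Field.absoluteGaloisGroup K),
      κ.IsTopGenerator γ → ∀ (jbar : AlgebraicClosure K →+* ℂ)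
        (D : (W.baseChange K).LambdaAdicSelmerData κ γ)
        (C : CastellaGrossiLeeSkinner2022.StabilizedHeegnerData (W.conductorNorm ℤ) W K κ jbar)
        (X : (W.baseChange K).SelmerDualData κ γ),
      Module.Finite (IwasawaAlgebra p) D.S → Module.Finite (IwasawaAlgebra p) X.X →
      Module.IsTorsion (IwasawaAlgebra p) (D.S ⧸ CastellaGrossiLeeSkinner2022.stabilizedHeegnerModule D C) →
      (∀ 𝔭 : PrimeSpectrum (IwasawaAlgebra p), 𝔭.asIdeal = Ideal.span {(p : IwasawaAlgebra p)} →
          Module.lengthAt (IwasawaAlgebra p)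
            (D.S ⧸ CastellaGrossiLeeSkinner2022.stabilizedHeegnerModule D C) 𝔭 = 0) →
      Finite (↥(Submodule.torsion (IwasawaAlgebra p) X.X) ⧸
        (IwasawaAlgebra.augIdealP p •
          (⊤ : Submodule (IwasawaAlgebra p) ↥(Submodule.torsion (IwasawaAlgebra p) X.X))))

/-- **Ω1-F2♭ `Stmt.rungF2` (rev 2r; a RUNG of Ω1 — BC5-style evidence, NOT in the cone; FIRST PROVER TARGET per
V#33 P2).** On a light X10b Heegner frame at NON-ANOMALOUS `p` (`p ∤ #Ẽ(𝔽_p)`): for every stabilised `Λ`-adic Heegner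
datum `C` whose basic Heegner point `y_K = Norm_{K[1]/K} P[1]` (any point satisfying the tree's `IsHeegnerNormPoint …
C.Dt C.β jbar 0 1`) is NOT `p`-divisible in `E(K)` (no `Γ_K`-fixed geometric `Q` with `p•Q = y_K`), the class module
`Λκ_∞(C)` is NOT contained in `𝔪·𝔖`, `𝔪 = (p, T)`: i.e. `κ_∞ ∉ 𝔪𝔖`, whence (with `𝔖` free of rank one, CGS25
6.5.2) `𝔖 = Λκ_∞(C)` and Ω1's `μ(𝔖/Λκ_∞(C)) = 0` in this regime, with no reciprocity law. Mechanism (elementary):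
`pr_K(κ_∞) = u_K⁻¹(1 - α⁻¹)²·δ(y_K)` at EVERY torsion depth (CGLS22 Rem. 4.1.2: the `d(k)`-shifted classes
`κ_k = α^{-d(k)} Norm(P[p^{d(k)}]_α)` are norm-compatible down to `κ₀ = δ(Norm_{K[1]/K} P[1]_α)`), `α ≡ a_p (mod p)`
so `1 - α⁻¹ ∈ ℤ_p^×` iff `p ∤ #Ẽ(𝔽_p)`; `pr_K(𝔪𝔖) ⊆ p·S_p(E/K)` (`T = γ - 1` acts as `0` on the bottom layer,
`LambdaAdicSelmerData.proj_X` with `γ ∈ Γ_K = layerSubgroup 0`); and `δ(y_K) ∈ p·S_p(E/K) ⇒ y_K ∈ pE(K)` (`T_pШ`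
torsion-free, `E(K)[p] = 0` by (irr_K)); restriction `S_p(E/K) → S_p(E/K_k)` is injective mod `p` (`E(K_∞)[p] = 0`),
which transports the bottom-layer statement to the layers `k > δ` where `stabilizedHeegnerModule` is defined.
g6 CORRECTION of the rev-2 card's F2 (there typed over Howard's family module `ℋ_F`): at depth `δ = 0` the universal
norms of `ℋ` have bottom `Φ·y_K`, `Φ = (p - a_pσ + σ²)(p - a_pσ* + σ*²)` of augmentation `#Ẽ(𝔽_p)²` (Howard 2004
Lemmas 3.3.2–3.3.3), so the `ℋ_F` form is right there; at `δ ≥ 1` the family's layer-`δ` generators are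
`z_δ = γ̄_δ·u_δ` (`u_δ = Norm_{K[1]/K_δ} P[1]`, `γ̄_δ` of augmentation `ε_{δ+1}`, `ε₁ = a_p - 2`, `ε₂ = a_p ε₁ - 2`,
`ε_{k+1} = a_p ε_k - 3ε_{k-1}` at `p = 3` split) — a unit iff `a_p ≢ 1`, so PLAUSIBLY `ℋ_F = Λκ_∞(C)` there too, but
that unit computation is not in print; the stabilised form avoids it. Why it might fail: only through the tree
plumbing (bottom projection of `stabilizedHeegnerModule`, defined through the layers `k > δ`, via `proj_norm`).
Size S–M (prover-days). [cite: CastellaGrossiLeeSkinner2022, Rem. 4.1.2 (arXiv:2008.02571 p. 22)]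
[cite: Howard2004HeegnerKolyvagin, Lemmas 3.3.2–3.3.3 (arXiv:1202.6340 pp. 18–19)] [cite: PerrinRiou1987BSMF, §3.3 Cor. 5]
[cite: GrossZagier1986, §V.2 (y_K)] -/
def Stmt.rungF2 : Prop :=
    ∀ (W : WeierstrassCurve ℚ) [W.IsElliptic] [W.IsGloballyMinimal] (p : ℕ) [Fact p.Prime]
      [NeZero (W.conductorNorm ℤ)] (K : Type) [Field K] [NumberField K],
      ClassX10 W p → ¬ Surj W 3 → ¬ W.HasCM → ¬ p ∣ W.reductionPointCount p →
      IsImaginaryQuadratic K → Odd (NumberField.discr K) → NumberField.discr K ≠ -3 →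
      SatisfiesHeegnerHypothesis (W.conductorNorm ℤ) K → SatisfiesHeegnerHypothesis p K →
      (W.baseChange K).HasIrreducibleModPGaloisRep p →
      ∀ (κ : ZpExtension K p), κ.IsAnticyclotomic → ∀ (γ : Field.absoluteGaloisGroup K),
      κ.IsTopGenerator γ → ∀ (jbar : AlgebraicClosure K →+* ℂ)
        (D : (W.baseChange K).LambdaAdicSelmerData κ γ)
        (C : CastellaGrossiLeeSkinner2022.StabilizedHeegnerData (W.conductorNorm ℤ) W K κ jbar),
      (∀ y : geomPoints (W.baseChange K),
          IsHeegnerNormPoint (W.conductorNorm ℤ) W K κ C.Dt C.β jbar 0 1 y →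
          ¬ ∃ Q : geomPoints (W.baseChange K),
            (∀ σ : Field.absoluteGaloisGroup K, σ • Q = Q) ∧ (p : ℤ) • Q = y) →
      ¬ (CastellaGrossiLeeSkinner2022.stabilizedHeegnerModule D C ≤
          (Ideal.span {(p : IwasawaAlgebra p), (PowerSeries.X : IwasawaAlgebra p)}) •
            (⊤ : Submodule (IwasawaAlgebra p) D.S))

/-- **Ω3 `Stmt.lengthAtP_eq_zero_of_finiteQuotient` — pure `Λ`-algebra, IN THE TREE (support, PROVED below as
`lengthAtP_eq_zero_of_finiteQuotient_holds`; the seat's crux probe P1 found it: `crux.in-tree` via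
`Rank1Residual.KatoMuSkeleton.lengthAt_eq_zero_of_finite_quotient_p`, and flagged the torsion binder of the first
draft as unused — dropped): a finitely generated `Λ`-module `N` with `N/(p)·N` finite has no `(p)`-primary part,
`length_{Λ_(p)} N_(p) = 0`** (`T^c N ⊆ pN` for some `c`, then Nakayama / Cayley–Hamilton at `(p)`).
[cite: Washington1997, §13.2 (μ as the length at (p))] [cite: NSW2008, (5.3.9)–(5.3.10)] -/
def Stmt.lengthAtP_eq_zero_of_finiteQuotient : Prop :=
  ∀ (p : ℕ) [Fact p.Prime] (N : Type) [AddCommGroup N] [Module (IwasawaAlgebra p) N],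
    Module.Finite (IwasawaAlgebra p) N →
    Finite (N ⧸ (IwasawaAlgebra.augIdealP p • (⊤ : Submodule (IwasawaAlgebra p) N))) →
    ∀ 𝔭 : PrimeSpectrum (IwasawaAlgebra p), 𝔭.asIdeal = Ideal.span {(p : IwasawaAlgebra p)} →
      Module.lengthAt (IwasawaAlgebra p) N 𝔭 = 0

/-! ## §3 Registered stubs (the ONLY sorries of the file) -/

/-- `d_K` odd excludes `d_K = -4`. [folklore] -/
theorem discr_ne_neg_four_of_odd {K : Type} [Field K] [NumberField K] (hodd : Odd (NumberField.discr K)) :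
    NumberField.discr K ≠ -4 := by
  rintro h; rw [h] at hodd; exact absurd hodd (by decide)

/-- **stub s_cop (PROVED; MZ26 Cor 4.6 by name at `p = 3`)** — the lead's proof, verbatim (p607508).
[cite: MastellaZerman2026, Cor. 4.6 (arXiv:2505.08710)] [cite: LombardoTronto2022, Prop. 3.12] -/
theorem stub_coprimeTied : Stmt.coprimeTied := by
  intro hMZ W _ _ p _ _ K _ _ hX hns hcm hK hodd h3 hHN hHp _ κ hκ γ hγ Dt H _ jbar _ _ _ hhK
  have h46 : MastellaZerman2026.cor46_howardDivisibility_of_scalarImage.{0} := hMZ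
  obtain ⟨D, F, X, hFD, -, hle⟩ :=
    Summit.BirchSwinnertonDyer.BirchSwinnertonDyer.Rank1Residual.X10.heegnerContainmentPinned_of_cor46_of_not_surj
      h46 hX hns hcm hK h3 (discr_ne_neg_four_of_odd hodd) hHN hHp hhK κ hκ γ hγ Dt H jbar
  exact ⟨D, F, X, hFD, hle⟩

/-- **stub s_envGeom (OPEN, shared with the line of record; print-free CM geometry + Kummer theory).**
[cite: Howard2004HeegnerKolyvagin, §3.3] [cite: PerrinRiou1987BSMF, §3.3–3.4] [cite: CastellaGrossiLeeSkinner2022, §4.1, Rem. 4.1.4] -/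
theorem stub_envelopeGeom : Stmt.envelopeGeom := by
  sorry

/-- **stub Ω1 (OPEN, M; print modulo typing: ERL × Hsieh Thm B).** [cite: CastellaGrossiLeeSkinner2022, Prop. 4.2.1]
[cite: BurungaleCastellaSkinner2025, Prop. 4.2.2] [cite: Hsieh2014, Thm. B] -/
theorem stub_kappaIndivisible : Stmt.kappaIndivisible := by
  sorry

/-- **stub Ω2a (OPEN, L, PORT modulo the residual R-MR — seatable after F2♭ per V#33; the port seat STOPS AND
REPORTS if Mazur–Rubin 2004 Lemmas 3.5.4 / 3.7.4 use `End_{G_K}(T̄) = 𝔽_p`).** [cite: Howard2004HeegnerKolyvagin, §2.3–2.6, Thm. 1.6.1]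
[cite: MazurRubin2004, Lemmas 3.5.4, 3.7.4, §4.4] [cite: Sakamoto2018Gorenstein, Thm. 1.1] -/
theorem stub_omegaAdicCorankOne_nonAnomalous : Stmt.omegaAdicCorankOne_nonAnomalous := by
  sorry

/-- **stub Ω2c (OPEN, L–XL, RESEARCH — anomalous `3`; not seatable now).** [cite: Howard2004HeegnerKolyvagin, Lemma 3.2.7]
[cite: CastellaGrossiLeeSkinner2022, Thm. 3.3.1 proof] [cite: MazurRubin2004, §4.4] -/
theorem stub_omegaAdicCorankOne_anomalous : Stmt.omegaAdicCorankOne_anomalous := by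
  sorry

/-- **Ω2 is DERIVED (rev 2): case split on `p ∣ #Ẽ(𝔽_p)` (sorry-free).** [folklore] -/
theorem omegaAdicCorankOne_of_cases (ha : Stmt.omegaAdicCorankOne_nonAnomalous)
    (hc : Stmt.omegaAdicCorankOne_anomalous) : Stmt.omegaAdicCorankOne := by
  intro W _ _ p _ _ K _ _ hX hns hcm hK hodd h3 hHN hHp hirr κ hκ γ hγ jbar D C X hfinS hfinX htor hμ
  by_cases han : p ∣ W.reductionPointCount p
  · exact hc W p K hX hns hcm han hK hodd h3 hHN hHp hirr κ hκ γ hγ jbar D C X hfinS hfinX htor hμ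
  · exact ha W p K hX hns hcm han hK hodd h3 hHN hHp hirr κ hκ γ hγ jbar D C X hfinS hfinX htor hμ

/-- the rev-1 name, now a theorem of the two case stubs. [folklore] -/
theorem stub_omegaAdicCorankOne : Stmt.omegaAdicCorankOne :=
  omegaAdicCorankOne_of_cases stub_omegaAdicCorankOne_nonAnomalous stub_omegaAdicCorankOne_anomalous

/-- **stub Ω1-F2♭ (OPEN, S–M, elementary; the RUNG of Ω1, not in the cone; FIRST PROVER TARGET per V#33 P2).**
[cite: CastellaGrossiLeeSkinner2022, Rem. 4.1.2] [cite: Howard2004HeegnerKolyvagin, Lemmas 3.3.2–3.3.3] -/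
theorem stub_rungF2 : Stmt.rungF2 := by
  sorry

/-- Ω3 is a theorem of the tree (x9 μ-bookkeeping, `KatoMuSkeleton.lengthAt_eq_zero_of_finite_quotient_p`),
read at the prime written as `Ideal.span {(p : Λ)}` (`= augIdealP p` by `map_natCast`). [cite: Washington1997, §13.2] -/
theorem lengthAtP_eq_zero_of_finiteQuotient_holds : Stmt.lengthAtP_eq_zero_of_finiteQuotient := by
  intro p _ N _ _ hfin hfq 𝔭 h𝔭
  haveI := hfin
  haveI := hfq
  have hId : Ideal.span {(p : IwasawaAlgebra p)} = IwasawaAlgebra.augIdealP p := by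
    unfold IwasawaAlgebra.augIdealP
    rw [map_natCast]
  exact Summit.BirchSwinnertonDyer.BirchSwinnertonDyer.Rank1Residual.KatoMuSkeleton.lengthAt_eq_zero_of_finite_quotient_p
    (M := N) 𝔭 (h𝔭.trans hId)

/-! ## §4 Kernel (sorry-free): the line of record's μ-stub from Ω1 + Ω2 + Ω3 -/

/-- **`Stmt.muPartTied` (the lead's beyond-print stub) follows from the `Ω`-adic line.** From the bundle take
`(D, F, X, m)` with `(p^m)·I(ℋ_F)² ⊆ char(𝒳_tors)`; Ω1 gives a stabilized `C` with `𝔖/Λκ_∞(C)` torsion and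
`μ = 0`; Ω2 makes `𝒳_tors/3` finite; Ω3 makes `length_(3) 𝒳_tors = 0`; the promotion lemma removes `(p^m)`. -/
theorem muPartTied_of_omega
    (hΩ1 : Stmt.kappaIndivisible) (hΩ2 : Stmt.omegaAdicCorankOne)
    (hΩ3 : Stmt.lengthAtP_eq_zero_of_finiteQuotient) (hTw : AnticyclotomicTowerSharp) : Stmt.muPartTied := by
  intro W _ _ p _ _ K _ _ hX hns hcm hK hodd h3 hHN hHp hirr κ hκ γ hγ Dt H ιC jbar hc hrk hfin hhK
    ⟨D, F, X, m, hFDt, hfinS, hfinX, htor, hloc⟩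
  obtain ⟨C, htorC, hμC⟩ := hΩ1 hTw W p K hX hns hcm hK hodd h3 hHN hHp hirr κ hκ γ hγ jbar D
  have hfinq := hΩ2 W p K hX hns hcm hK hodd h3 hHN hHp hirr κ hκ γ hγ jbar D C X hfinS hfinX htorC hμC
  haveI := hfinX
  haveI : IsNoetherian (IwasawaAlgebra p) X.X := isNoetherian_of_isNoetherianRing_of_finite _ _
  have hfinT : Module.Finite (IwasawaAlgebra p) (Submodule.torsion (IwasawaAlgebra p) X.X) := inferInstance
  have hμ := hΩ3 p (Submodule.torsion (IwasawaAlgebra p) X.X) hfinT hfinq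
  exact ⟨D, F, X, hFDt, IwasawaAlgebra.le_charIdeal_of_span_p_pow_mul_le
    (Submodule.torsion_isTorsion (R := IwasawaAlgebra p) (M := X.X)) hμ hloc⟩

/-! ## §5 Composition (sorry-free, concludes the crux BY NAME) — the line of record's V22 composition verbatim,
against the route's rev-31 decls, with `s_mu := muPartTied_of_omega …` -/

/-- Ideal bookkeeping: `(a) · ((b) · I)² = (a·b²) · I²`. [folklore] -/
theorem span_singleton_mul_sq {R : Type*} [CommSemiring R] (a b : R) (I : Ideal R) :
    Ideal.span {a} * (Ideal.span {b} * I) ^ 2 = Ideal.span {a * b ^ 2} * I ^ 2 := by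
  rw [mul_pow, Ideal.span_singleton_pow, ← mul_assoc, Ideal.span_singleton_mul_span_singleton]

/-- Local ALIAS of the deciding crux decl (so that exactly one theorem, `…_of_stubs`, is crux-headed). -/
def Goal : Prop := HowardContainmentLightFrameX10bPinnedOfPrint

/-- **Composition**: fix the frame, `jbar := IsAlgClosed.lift` along `ιC`; `3 ∤ h_K` ↦ `s_cop hMZ`; `3 ∣ h_K` ↦ `D`,
`X` exist; `(C, F, e, g)` ← `s_envGeom hTw♯`; CGLS 4.1.1 (binder `hNV`) at `(D, C)` ⇒ `𝔖` torsion-free, `𝔖/Λκ_C`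
torsion ⇒ `𝔖/ℋ_F` torsion; CGS 6.5.2 (binder `hCGS`) ⇒ finiteness / rank one, `(p^m)·I(Λκ_C)² ⊆ char`;
⇒ `(p^(m+2e))·I(ℋ_F)² ⊆ char` ⇒ `s_mu` (given the tower binder, which Ω1 consumes). -/
theorem HowardContainmentLightFrameX10bPinnedOfPrint_of
    (s_cop : Stmt.coprimeTied) (s_env : Stmt.envelopeGeom) (s_mu : AnticyclotomicTowerSharp → Stmt.muPartTied) :
    Goal := by
  unfold Goal
  intro hMZ hNV hCGS hTw W _ _ p _ _ K _ _ hX hns hcm hK hodd h3 hHN hHp hirr κ hκ γ hγ Dt H ιC hc hrk hfin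
  letI : Algebra K ℂ := ιC.toAlgebra
  let jbar : AlgebraicClosure K →+* ℂ :=
    (IsAlgClosed.lift (R := K) (M := ℂ) (S := AlgebraicClosure K)).toRingHom
  by_cases hhK : p ∣ NumberField.classNumber K
  · obtain ⟨D⟩ := LambdaAdicSelmerDataExists.nonempty_lambdaAdicSelmerData (W.baseChange K) p κ hγ
    obtain ⟨X⟩ := (W.baseChange K).nonempty_selmerDualData_holds κ γ hγ
    obtain ⟨C, F, e, g, -, hFDt, hle, hg, hrev⟩ :=
      s_env hTw W p K hX hns hcm hK hodd h3 hHN hHp hirr κ hκ γ hγ Dt H jbar D hc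
    have hyp := Summit.BirchSwinnertonDyer.BirchSwinnertonDyer.Rank1Residual.X10.thm413Hypotheses_of_classX10
      hX hK h3 hHN hHp hodd hκ hγ
    have h411 : CastellaGrossiLeeSkinner2022.thm411_torsionFree_heegnerClass_ne_bot_quotient_isTorsion.{0} :=
      fun N _ W _ K _ _ p _ κ γ jbar hyp D C => hNV N W K p κ γ jbar hyp D C
    obtain ⟨hfree, -, htorC⟩ := h411 (W.conductorNorm ℤ) W K p κ γ jbar hyp D C
    haveI := hfree
    have h652 : CastellaGrossiSkinner2025.thm652_stabilized_rankOne_charIdeal_torsion_dvd_pLocalized.{0} :=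
      fun N _ W _ K _ _ p _ κ γ jbar hyp D C X => hCGS N W K p κ γ jbar hyp D C X
    obtain ⟨⟨hfinS, hS1⟩, hfinX, -⟩ := h652 (W.conductorNorm ℤ) W K p κ γ jbar hyp D C X
    haveI := hfinS
    obtain ⟨m, hm⟩ := CastellaGrossiSkinner2025.span_pow_mul_sq_le_charIdeal_torsion_of_thm652_stabilized h652
      hyp D C X
    have htor : Module.IsTorsion (IwasawaAlgebra p) (D.S ⧸ heegnerModule D F) :=
      isTorsion_quotient_heegnerModule_of_smul_stabilizedHeegnerModule_le D F C hg hrev htorC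
    have henv : Ideal.span {((p : IwasawaAlgebra p) ^ e)} * heegnerCharIdeal D F ≤
        CastellaGrossiLeeSkinner2022.stabilizedHeegnerCharIdeal D C :=
      span_pow_mul_heegnerCharIdeal_le_stabilizedHeegnerCharIdeal_of_pow_smul_le D hS1 F C e hle htor
    have hloc : Ideal.span {((p : IwasawaAlgebra p) ^ (m + e * 2))} * heegnerCharIdeal D F ^ 2 ≤
        Module.charIdeal (IwasawaAlgebra p) (Submodule.torsion (IwasawaAlgebra p) X.X) := by
      calc Ideal.span {((p : IwasawaAlgebra p) ^ (m + e * 2))} * heegnerCharIdeal D F ^ 2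
          = Ideal.span {((p : IwasawaAlgebra p) ^ m)} *
              (Ideal.span {((p : IwasawaAlgebra p) ^ e)} * heegnerCharIdeal D F) ^ 2 := by
            rw [span_singleton_mul_sq, ← pow_mul, ← pow_add]
        _ ≤ Ideal.span {((p : IwasawaAlgebra p) ^ m)} *
              CastellaGrossiLeeSkinner2022.stabilizedHeegnerCharIdeal D C ^ 2 :=
            Ideal.mul_mono_right (Ideal.pow_right_mono henv 2)
        _ ≤ _ := hm
    obtain ⟨D', F', X', hF', hle'⟩ := s_mu hTw W p K hX hns hcm hK hodd h3 hHN hHp hirr κ hκ γ hγ Dt H ιC jbar hc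
      hrk hfin hhK ⟨D, F, X, m + e * 2, hFDt, hfinS, hfinX, htor, hloc⟩
    exact ⟨jbar, D', F', X', hF', hle'⟩
  · obtain ⟨D, F, X, hF, hle⟩ := s_cop hMZ W p K hX hns hcm hK hodd h3 hHN hHp hirr κ hκ γ hγ Dt H ιC jbar hc hrk
      hfin hhK
    exact ⟨jbar, D, F, X, hF, hle⟩

/-- the composed line (rev-1 path, kept): the deciding crux 27275 BY NAME (sorries only through the open `stub_*`:
`stub_envelopeGeom` (shared with the line of record), `stub_kappaIndivisible` (Ω1), Ω2a/Ω2c via `stub_omegaAdicCorankOne`). -/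
theorem HowardContainmentLightFrameX10bPinnedOfPrint_of_stubs : HowardContainmentLightFrameX10bPinnedOfPrint :=
  (HowardContainmentLightFrameX10bPinnedOfPrint_of stub_coprimeTied stub_envelopeGeom
    (muPartTied_of_omega stub_kappaIndivisible stub_omegaAdicCorankOne lengthAtP_eq_zero_of_finiteQuotient_holds) : Goal)

/-- stmt-27274 `HowardContainmentLightFrameX10bPinned` BY NAME, given the four print binders of 27275. -/
theorem HowardContainmentLightFrameX10bPinned_of_stubs
    (hMZ : MastellaZermanHowardDivisibility) (hNV : CGLSHeegnerClassNonvanishing)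
    (hCGS : CGSHowardDivisibilityPLocalized) (hTw : AnticyclotomicTowerSharp) :
    HowardContainmentLightFrameX10bPinned :=
  HowardContainmentLightFrameX10bPinnedOfPrint_of_stubs hMZ hNV hCGS hTw

/-! ## §6 (rev 2) The LIVE split crux stmt-27487 `PrintX10b.MuPartSharpX10b` BY NAME, and the parent 27275
through the route's own split items 27485 / 27486 / 27488 BY NAME -/

/-- `MuPartSharpX10b` (route file, rev 37) is `Stmt.muPartTied` up to the order of the two `Module.Finite` conjuncts
of the bundle: the adapter. -/
theorem muPartSharpX10b_of
    (hΩ1 : Stmt.kappaIndivisible) (hΩ2 : Stmt.omegaAdicCorankOne)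
    (hΩ3 : Stmt.lengthAtP_eq_zero_of_finiteQuotient) (hTw : AnticyclotomicTowerSharp) : MuPartSharpX10b := by
  intro W _ _ p _ _ K _ _ hX hns hcm hK hodd h3 hHN hHp hirr κ hκ γ hγ Dt H ιC jbar hc hrk hfin hhK
    ⟨D, F, X, m, hFDt, hfinX, hfinS, htor, hloc⟩
  exact muPartTied_of_omega hΩ1 hΩ2 hΩ3 hTw W p K hX hns hcm hK hodd h3 hHN hHp hirr κ hκ γ hγ Dt H ιC jbar hc
    hrk hfin hhK ⟨D, F, X, m, hFDt, hfinS, hfinX, htor, hloc⟩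

/-- **stmt-27487 `MuPartSharpX10b` BY NAME from the stubs** (sorries only through `stub_kappaIndivisible` (Ω1),
`stub_omegaAdicCorankOne_nonAnomalous` (Ω2a), `stub_omegaAdicCorankOne_anomalous` (Ω2c)), given the route's
Tower♯ binder (a support item, proved classical CFT). -/
theorem muPartSharpX10b_of_stubs (hTw : AnticyclotomicTowerSharp) : MuPartSharpX10b :=
  muPartSharpX10b_of stub_kappaIndivisible stub_omegaAdicCorankOne lengthAtP_eq_zero_of_finiteQuotient_holds hTw

/-- **The parent 27275 through the route's split (items 27485 `CoprimeTiedX10b`, 27486 `EnvelopeModulesSharpX10b`,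
27488 `HowardContainmentLightFrameX10bPinnedOfPrintOfSplit` BY NAME) and Ω1, Ω2a, Ω2c** (sorry-free). -/
theorem parent_of_split (h85 : CoprimeTiedX10b) (h86 : EnvelopeModulesSharpX10b)
    (h88 : HowardContainmentLightFrameX10bPinnedOfPrintOfSplit)
    (hΩ1 : Stmt.kappaIndivisible) (hΩ2a : Stmt.omegaAdicCorankOne_nonAnomalous)
    (hΩ2c : Stmt.omegaAdicCorankOne_anomalous) : HowardContainmentLightFrameX10bPinnedOfPrint := by
  intro hMZ hNV hCGS hTw
  exact h88 h85 h86 (muPartSharpX10b_of hΩ1 (omegaAdicCorankOne_of_cases hΩ2a hΩ2c)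
    lengthAtP_eq_zero_of_finiteQuotient_holds hTw) hMZ hNV hCGS hTw

end Summit.BirchSwinnertonDyer.BirchSwinnertonDyer.Cruxes.HowardContainmentAnyClassNumberX10b.OmegaAdicMuX10b

end
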